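import Summits.QuantumFields.YangMills.Theorems.AllWindowsColdBoxBoxHighLineRestrictionMoments

/-!
# U5 ε₂-glue (G2c-1): the single-average D-truncation transfer for a GENERAL measurable set `D′` (the CUT small field of ASSEMBLY-U5 §3)

Free-hands helper of the κ-lineage (ym-line-fcl-p3 g27) for Steps D–E of the NEXT rung U5 (`stub_landauThirdOrder`, LINE-20, ⟨stmt-QuantumFields-24336⟩).
Planner ym-idea-2 g18's `Cruxes/BoxWindowHighSU2213/ASSEMBLY-U5.md` v0.1 §3 runs the third-order tilt expansion on the CUT small field
`D′ := smallField H s ∩ {|βV₃| ≤ 1}` (lift L4), i.e. over `μ_{D′} := (volume.restrict D′).withDensity (ofReal ∘ gaussWeight β H)`, and evaluates `f′(0)`, `f″(0)`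
EXACTLY by Wick under the FULL Gaussian `E₀ = gaussAvg β H` — «up to the D-truncation».  ✓`…RestrictionMoments`/✓`…RestrictionCum3` (G2a/G2b) did the transfer in the
`sfInd H s`/`smallField` letters; this file re-letters the `μ`-plumbing and the single-average transfer for an ARBITRARY measurable `D ⊆ (LandauFree H → E3)` with
indicator `1_D = D.indicator (fun _ => 1)` (so `sfInd H s` is the instance `D = smallField H s` by `rfl`, and the cut set `D′` is admissible; its co-mass
`τ″ = E₀[1 − 1_{D′}] ≤ τ + (Gaussian cubic tail)` comes from ✓6g + ✓`GaussianPolyTail`):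

* §0 indicator algebra and the measure `μ_D` for general `D`: `integral_muSet_eq` (`∫ F dμ_D = ∫ 1_D·F·gaussWeight`), `isFiniteMeasure_muSet`, `neZero_muSet`,
  `ae_muSet_mem`, `ae_muSet_eq_indicator_mul`, ★`tiltExp_muSet_zero_eq` (`E_0^{μ_D}[G] = E₀[1_D·G]/E₀[1_D]`, any tilt letter), `gaussAvg_indicator_eq` (`E₀[1_D] = 1 − E₀[1 − 1_D]`);
* §1 the single-average transfer with MOMENT hypotheses (copies of G2a §1 in set letters): ★`abs_gaussAvg_one_sub_indicator_mul_le` (`|E₀[(1−1_D)V]| ≤ √τ·√E₀[V²]`),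
  ★`abs_rSet_sub_gaussAvg_le` (`|E₀[1_D V]/E₀[1_D] − E₀[V]| ≤ 2τ|E₀V| + 2√τ·√E₀[V²]`, `τ ≤ 1/2`), `abs_rSet_sub_gaussAvg_le_of_sq_le` (`≤ 4√τ·√A`), `abs_rSet_le`
  (`≤ 2√E₀[V²]`), `half_le_gaussAvg_indicator`, `integral_indicator_mul_gaussWeight_pos`.
The third- and fourth-cumulant transfers over `μ_D` for general `D` are `…RestrictionSetCum3/4.lean`.

No definitions; standard axioms.  HONEST LABEL: helper-grade glue for U5 prep; U5, ⟨24004⟩, ⟨24336⟩ remain OPEN; route AllWindowsColdBox is DRAFT;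
no crux, rung or summit is proved; the Yang–Mills mass gap is NOT proved by this file; no summit is proved by a line.
-/

set_option autoImplicit false

noncomputable section

open MeasureTheory Set

namespace Summit.QuantumFields.YangMills.Theorems.AllWindowsColdBoxBoxHighLine

namespace GaussRestrict

variable {H : ℕ} {β : ℝ}

/-! ## §0 Indicator algebra and the restricted Gaussian measure `μ_D` for a general measurable `D` -/

/-- `1_D · 1_D = 1_D`. -/
theorem indicator_one_mul_self (D : Set (LandauFree H → E3)) (a : LandauFree H → E3) :
    D.indicator (fun _ => (1 : ℝ)) a * D.indicator (fun _ => (1 : ℝ)) a = D.indicator (fun _ => (1 : ℝ)) a := by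
  by_cases ha : a ∈ D
  · rw [Set.indicator_of_mem ha, mul_one]
  · rw [Set.indicator_of_notMem ha, mul_zero]

/-- `(1 − 1_D)·(1 − 1_D) = 1 − 1_D`. -/
theorem one_sub_indicator_mul_self (D : Set (LandauFree H → E3)) (a : LandauFree H → E3) :
    (1 - D.indicator (fun _ => (1 : ℝ)) a) * (1 - D.indicator (fun _ => (1 : ℝ)) a) = 1 - D.indicator (fun _ => (1 : ℝ)) a := by
  have h := indicator_one_mul_self D a
  ring_nf
  rw [sq, h]
  ring

/-- `0 ≤ 1_D ≤ 1`. -/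
theorem indicator_one_nonneg_le_one (D : Set (LandauFree H → E3)) (a : LandauFree H → E3) :
    0 ≤ D.indicator (fun _ => (1 : ℝ)) a ∧ D.indicator (fun _ => (1 : ℝ)) a ≤ 1 := by
  by_cases ha : a ∈ D
  · rw [Set.indicator_of_mem ha]; exact ⟨zero_le_one, le_rfl⟩
  · rw [Set.indicator_of_notMem ha]; exact ⟨le_rfl, zero_le_one⟩

/-- `|1 − 1_D| ≤ 1`. -/
theorem abs_one_sub_indicator_le (D : Set (LandauFree H → E3)) (a : LandauFree H → E3) : |1 - D.indicator (fun _ => (1 : ℝ)) a| ≤ 1 := by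
  obtain ⟨h0, h1⟩ := indicator_one_nonneg_le_one D a
  rw [abs_le]; constructor <;> linarith

/-- `|1_D · P| ≤ B` everywhere when `|P| ≤ B` on `D` (`0 ≤ B`). -/
theorem abs_indicator_one_mul_le {D : Set (LandauFree H → E3)} {P : (LandauFree H → E3) → ℝ} {B : ℝ} (hB : 0 ≤ B) (hP : ∀ a ∈ D, |P a| ≤ B)
    (a : LandauFree H → E3) : |D.indicator (fun _ => (1 : ℝ)) a * P a| ≤ B := by
  by_cases ha : a ∈ D
  · rw [Set.indicator_of_mem ha, one_mul]; exact hP a ha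
  · rw [Set.indicator_of_notMem ha, zero_mul, abs_zero]; exact hB

/-- `1_D · F = 1_D · G` as soon as `F = G` on `D`. -/
theorem indicator_one_mul_congr_on {D : Set (LandauFree H → E3)} {F G : (LandauFree H → E3) → ℝ} (h : ∀ a ∈ D, F a = G a) :
    (fun a => D.indicator (fun _ => (1 : ℝ)) a * F a) = fun a => D.indicator (fun _ => (1 : ℝ)) a * G a := by
  funext a
  by_cases ha : a ∈ D
  · rw [Set.indicator_of_mem ha, h a ha]
  · rw [Set.indicator_of_notMem ha, zero_mul, zero_mul]

/-- On `D` the truncation `1_D·F` is `F`. -/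
theorem indicator_one_mul_eq_on {D : Set (LandauFree H → E3)} (F : (LandauFree H → E3) → ℝ) {a : LandauFree H → E3} (ha : a ∈ D) :
    D.indicator (fun _ => (1 : ℝ)) a * F a = F a := by
  rw [Set.indicator_of_mem ha, one_mul]

/-- `sfInd H s` is the instance `D = smallField H s` (definitional). -/
theorem sfInd_eq_indicator (s : ℝ) : sfInd H s = (smallField H s).indicator (fun _ => (1 : ℝ)) := rfl

/-- **`∫ F dμ_D = ∫ 1_D · (F · gaussWeight)`** for a measurable `D` (any `F`; `β > 0`). -/
theorem integral_muSet_eq (hβ : 0 < β) {D : Set (LandauFree H → E3)} (hD : MeasurableSet D) (F : (LandauFree H → E3) → ℝ) :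
    ∫ a, F a ∂(((volume : Measure (LandauFree H → E3)).restrict D).withDensity fun a => ENNReal.ofReal (gaussWeight β H a)) =
      ∫ a, D.indicator (fun _ => (1 : ℝ)) a * (F a * gaussWeight β H a) := by
  have hw : AEMeasurable (fun a : LandauFree H → E3 => ENNReal.ofReal (gaussWeight β H a)) (volume.restrict D) :=
    (EdgeChartGaussian.aestronglyMeasurable_gaussWeight H hβ).aemeasurable.ennreal_ofReal.restrict
  rw [integral_withDensity_eq_integral_toReal_smul₀ hw (Filter.Eventually.of_forall fun _ => ENNReal.ofReal_lt_top) F]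
  simp only [ENNReal.toReal_ofReal (EdgeChartGaussian.gaussWeight_pos β H _).le, smul_eq_mul]
  rw [← integral_indicator hD]
  refine integral_congr_ae (Filter.Eventually.of_forall fun a => ?_)
  by_cases ha : a ∈ D
  · simp only [Set.indicator_of_mem ha, one_mul, mul_comm]
  · simp only [Set.indicator_of_notMem ha, zero_mul]

/-- `μ_D(Ω) = ∫ 1_D · gaussWeight`. -/
theorem muSet_univ_toReal (hβ : 0 < β) {D : Set (LandauFree H → E3)} (hD : MeasurableSet D) :
    (((volume : Measure (LandauFree H → E3)).restrict D).withDensity fun a => ENNReal.ofReal (gaussWeight β H a)).real univ =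
      ∫ a, D.indicator (fun _ => (1 : ℝ)) a * gaussWeight β H a := by
  have h := integral_muSet_eq hβ hD fun _ => (1 : ℝ)
  simp only [one_mul, integral_const, smul_eq_mul, mul_one] at h
  exact h

/-- `μ_D` is a finite measure. -/
theorem isFiniteMeasure_muSet (hβ : 0 < β) (D : Set (LandauFree H → E3)) :
    IsFiniteMeasure (((volume : Measure (LandauFree H → E3)).restrict D).withDensity fun a => ENNReal.ofReal (gaussWeight β H a)) :=
  isFiniteMeasure_withDensity_ofReal (EdgeChartGaussian.integrable_gaussWeight H hβ).restrict.hasFiniteIntegral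

/-- `μ_D ≠ 0` as soon as `∫ 1_D · gaussWeight > 0`. -/
theorem neZero_muSet (hβ : 0 < β) {D : Set (LandauFree H → E3)} (hD : MeasurableSet D)
    (hpos : 0 < ∫ a, D.indicator (fun _ => (1 : ℝ)) a * gaussWeight β H a) :
    NeZero (((volume : Measure (LandauFree H → E3)).restrict D).withDensity fun a => ENNReal.ofReal (gaussWeight β H a)) := by
  refine ⟨fun h0 => ?_⟩
  have h := muSet_univ_toReal hβ hD
  rw [h0, measureReal_def, Measure.coe_zero, Pi.zero_apply, ENNReal.toReal_zero] at h
  linarith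

/-- `μ_D`-almost every field lies in `D`. -/
theorem ae_muSet_mem (β : ℝ) {D : Set (LandauFree H → E3)} (hD : MeasurableSet D) :
    ∀ᵐ a ∂(((volume : Measure (LandauFree H → E3)).restrict D).withDensity fun a => ENNReal.ofReal (gaussWeight β H a)), a ∈ D :=
  (withDensity_absolutelyContinuous _ _) (ae_restrict_mem hD)

/-- `μ_D`-a.e. the truncation `1_D·F` is `F`. -/
theorem ae_muSet_eq_indicator_mul (β : ℝ) {D : Set (LandauFree H → E3)} (hD : MeasurableSet D) (F : (LandauFree H → E3) → ℝ) :
    F =ᵐ[((volume : Measure (LandauFree H → E3)).restrict D).withDensity fun a => ENNReal.ofReal (gaussWeight β H a)]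
      fun a => D.indicator (fun _ => (1 : ℝ)) a * F a := by
  filter_upwards [ae_muSet_mem β hD] with a ha
  rw [indicator_one_mul_eq_on F ha]

/-- ★ **`E_0^{μ_D}[G] = E₀[1_D · G] / E₀[1_D]`** in `gaussAvg` letters (any tilt letter `U`; general measurable `D`). -/
theorem tiltExp_muSet_zero_eq (hβ : 0 < β) {D : Set (LandauFree H → E3)} (hD : MeasurableSet D) (U G : (LandauFree H → E3) → ℝ) :
    Tilt.tiltExp ((((volume : Measure (LandauFree H → E3)).restrict D).withDensity fun a => ENNReal.ofReal (gaussWeight β H a))) U 0 G =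
      gaussAvg β H (fun a => D.indicator (fun _ => (1 : ℝ)) a * G a) / gaussAvg β H (D.indicator (fun _ => (1 : ℝ))) := by
  have hZ := EdgeChartGaussian.integral_gaussWeight_pos H hβ
  unfold Tilt.tiltExp gaussAvg
  simp only [zero_mul, Real.exp_zero, mul_one]
  rw [integral_muSet_eq hβ hD, integral_muSet_eq hβ hD, div_div_div_cancel_right₀ hZ.ne']
  congr 1 <;> refine integral_congr_ae (Filter.Eventually.of_forall fun a => ?_) <;> ring

/-- `1_D · gaussWeight` is integrable. -/
theorem integrable_indicator_mul_gaussWeight (hβ : 0 < β) {D : Set (LandauFree H → E3)} (hD : MeasurableSet D) :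
    Integrable fun a : LandauFree H → E3 => D.indicator (fun _ => (1 : ℝ)) a * gaussWeight β H a :=
  Tilt.integrable_bdd_mul_gaussWeight H hβ (measurable_const.indicator hD) (C := 1) fun a => by
    obtain ⟨h0, h1⟩ := indicator_one_nonneg_le_one D a
    rw [abs_of_nonneg h0]; exact h1

/-- **`E₀[1_D] = 1 − E₀[1 − 1_D]`.** -/
theorem gaussAvg_indicator_eq (hβ : 0 < β) {D : Set (LandauFree H → E3)} (hD : MeasurableSet D) :
    gaussAvg β H (D.indicator (fun _ => (1 : ℝ))) = 1 - gaussAvg β H (fun a => 1 - D.indicator (fun _ => (1 : ℝ)) a) := by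
  have hI := integrable_indicator_mul_gaussWeight hβ hD
  have hw := EdgeChartGaussian.integrable_gaussWeight H hβ
  have hc : Integrable (fun a : LandauFree H → E3 => (1 - D.indicator (fun _ => (1 : ℝ)) a) * gaussWeight β H a) :=
    (hw.sub hI).congr (Filter.Eventually.of_forall fun a => by simp only [Pi.sub_apply]; ring)
  have hsum := EdgeChartGaussian.gaussAvg_add β H hI hc
  have e : (fun a : LandauFree H → E3 => D.indicator (fun _ => (1 : ℝ)) a + (1 - D.indicator (fun _ => (1 : ℝ)) a)) = fun _ => (1 : ℝ) := by
    funext a; ring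
  rw [e, EdgeChartGaussian.gaussAvg_const_fun H hβ] at hsum
  have : gaussAvg β H (fun a => D.indicator (fun _ => (1 : ℝ)) a) = gaussAvg β H (D.indicator (fun _ => (1 : ℝ))) := rfl
  linarith

/-- `|v| ≤ (1 + v²)/2` (private copy). -/
private theorem abs_le_half_one_add_sq (v : ℝ) : |v| ≤ (1 + v ^ 2) / 2 := by
  nlinarith [sq_nonneg (|v| - 1), sq_abs v, abs_nonneg v]

/-! ## §1 The single-average transfer `E₀[1_D V]/E₀[1_D]` versus `E₀[V]` -/

/-- ★ **The co-small-field tail of an L² observable**: `E₀[1 − 1_D] ≤ τ` ⇒ `|E₀[(1 − 1_D)·V]| ≤ √τ·√E₀[V²]`. -/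
theorem abs_gaussAvg_one_sub_indicator_mul_le (hβ : 0 < β) {D : Set (LandauFree H → E3)} (hD : MeasurableSet D) {τ : ℝ} (hτ : gaussAvg β H (fun a => 1 - D.indicator (fun _ => (1 : ℝ)) a) ≤ τ)
    {V : (LandauFree H → E3) → ℝ} (hV : Measurable V) (hV2 : Integrable (fun a => V a ^ 2 * gaussWeight β H a)) :
    |gaussAvg β H (fun a => (1 - D.indicator (fun _ => (1 : ℝ)) a) * V a)| ≤ Real.sqrt τ * Real.sqrt (gaussAvg β H (fun a => V a ^ 2)) := by
  have hm : Measurable fun a : LandauFree H → E3 => 1 - D.indicator (fun _ => (1 : ℝ)) a := measurable_const.sub ((measurable_const.indicator hD : Measurable (D.indicator (fun _ => (1 : ℝ)))))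
  have hF2 : Integrable (fun a : LandauFree H → E3 => (1 - D.indicator (fun _ => (1 : ℝ)) a) ^ 2 * gaussWeight β H a) :=
    Tilt.integrable_bdd_mul_gaussWeight H hβ (hm.pow_const 2) (C := 1) fun a => by
      rw [sq, one_sub_indicator_mul_self]; exact abs_one_sub_indicator_le D a
  have hV1 := integrable_mul_gaussWeight_of_sq hβ hV hV2
  have hFG : Integrable (fun a : LandauFree H → E3 => (1 - D.indicator (fun _ => (1 : ℝ)) a) * V a * gaussWeight β H a) := by
    have hG : Integrable (fun a : LandauFree H → E3 => (1 + V a ^ 2) / 2 * gaussWeight β H a) := by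
      have h1 := EdgeChartGaussian.integrable_gaussWeight H hβ
      exact ((h1.add hV2).div_const 2).congr (Filter.Eventually.of_forall fun a => by simp only [Pi.add_apply]; ring)
    refine EdgeChartGaussian.integrable_mul_gaussWeight_of_abs_le H hβ (hm.mul hV) hG fun a => ?_
    rw [abs_mul]
    calc |1 - D.indicator (fun _ => (1 : ℝ)) a| * |V a| ≤ 1 * |V a| := mul_le_mul_of_nonneg_right (abs_one_sub_indicator_le D a) (abs_nonneg _)
      _ ≤ (1 + V a ^ 2) / 2 := by rw [one_mul]; exact abs_le_half_one_add_sq (V a)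
  have h := EdgeChartGaussian.abs_gaussAvg_mul_le_sqrt H hβ hF2 hV2 hFG
  have hsq : gaussAvg β H (fun a => (1 - D.indicator (fun _ => (1 : ℝ)) a) ^ 2) = gaussAvg β H (fun a => 1 - D.indicator (fun _ => (1 : ℝ)) a) := by
    congr 1; funext a; rw [sq, one_sub_indicator_mul_self]
  rw [hsq] at h
  exact h.trans (mul_le_mul_of_nonneg_right (Real.sqrt_le_sqrt hτ) (Real.sqrt_nonneg _))

/-- `E₀[1_D V] = E₀[V] − E₀[(1 − 1_D)V]`. -/
theorem gaussAvg_indicator_mul_eq_sub (hβ : 0 < β) {D : Set (LandauFree H → E3)} (hD : MeasurableSet D) {V : (LandauFree H → E3) → ℝ} (hV : Measurable V)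
    (hV2 : Integrable (fun a => V a ^ 2 * gaussWeight β H a)) :
    gaussAvg β H (fun a => D.indicator (fun _ => (1 : ℝ)) a * V a) = gaussAvg β H V - gaussAvg β H (fun a => (1 - D.indicator (fun _ => (1 : ℝ)) a) * V a) := by
  have hV1 := integrable_mul_gaussWeight_of_sq hβ hV hV2
  have hDV : Integrable (fun a : LandauFree H → E3 => D.indicator (fun _ => (1 : ℝ)) a * V a * gaussWeight β H a) := by
    have hG : Integrable (fun a : LandauFree H → E3 => (1 + V a ^ 2) / 2 * gaussWeight β H a) := by
      have h1 := EdgeChartGaussian.integrable_gaussWeight H hβ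
      exact ((h1.add hV2).div_const 2).congr (Filter.Eventually.of_forall fun a => by simp only [Pi.add_apply]; ring)
    refine EdgeChartGaussian.integrable_mul_gaussWeight_of_abs_le H hβ (((measurable_const.indicator hD : Measurable (D.indicator (fun _ => (1 : ℝ))))).mul hV) hG fun a => ?_
    obtain ⟨h0, h1⟩ := indicator_one_nonneg_le_one D a
    rw [abs_mul, abs_of_nonneg h0]
    calc D.indicator (fun _ => (1 : ℝ)) a * |V a| ≤ 1 * |V a| := mul_le_mul_of_nonneg_right h1 (abs_nonneg _)
      _ ≤ (1 + V a ^ 2) / 2 := by rw [one_mul]; exact abs_le_half_one_add_sq (V a)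
  have e : (fun a : LandauFree H → E3 => V a) = fun a => D.indicator (fun _ => (1 : ℝ)) a * V a + (1 - D.indicator (fun _ => (1 : ℝ)) a) * V a := by funext a; ring
  have hcV : Integrable (fun a : LandauFree H → E3 => (1 - D.indicator (fun _ => (1 : ℝ)) a) * V a * gaussWeight β H a) :=
    (hV1.sub hDV).congr (Filter.Eventually.of_forall fun a => by simp only [Pi.sub_apply]; ring)
  have h := EdgeChartGaussian.gaussAvg_add β H hDV hcV
  rw [← e] at h
  linarith

/-- `E₀[1_D] ≥ 1/2 > 0` under `E₀[1 − 1_D] ≤ τ ≤ 1/2`. -/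
theorem half_le_gaussAvg_indicator (hβ : 0 < β) {D : Set (LandauFree H → E3)} (hD : MeasurableSet D) {τ : ℝ} (hτ : gaussAvg β H (fun a => 1 - D.indicator (fun _ => (1 : ℝ)) a) ≤ τ) (hτ2 : τ ≤ 1 / 2) :
    1 / 2 ≤ gaussAvg β H (D.indicator (fun _ => (1 : ℝ))) := by
  rw [gaussAvg_indicator_eq hβ hD]; linarith

/-- `0 < ∫ 1_D·gaussWeight` under `E₀[1 − 1_D] ≤ τ ≤ 1/2` (the `hD` of the `μ_D`-lemmas). -/
theorem integral_indicator_mul_gaussWeight_pos (hβ : 0 < β) {D : Set (LandauFree H → E3)} (hD : MeasurableSet D) {τ : ℝ} (hτ : gaussAvg β H (fun a => 1 - D.indicator (fun _ => (1 : ℝ)) a) ≤ τ)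
    (hτ2 : τ ≤ 1 / 2) : 0 < ∫ a, D.indicator (fun _ => (1 : ℝ)) a * gaussWeight β H a := by
  have h := half_le_gaussAvg_indicator hβ hD hτ hτ2
  have hZ := EdgeChartGaussian.integral_gaussWeight_pos H hβ
  unfold gaussAvg at h
  by_contra hneg
  have hneg' : (∫ a, D.indicator (fun _ => (1 : ℝ)) a * gaussWeight β H a) ≤ 0 := not_lt.1 hneg
  have : (∫ a, D.indicator (fun _ => (1 : ℝ)) a * gaussWeight β H a) / ∫ a, gaussWeight β H a ≤ 0 := div_nonpos_of_nonpos_of_nonneg hneg' hZ.le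
  linarith

/-- `0 ≤ τ` (it dominates `E₀[1 − 1_D] ≥ 0`). -/
theorem tau_nonneg_set (hβ : 0 < β) {D : Set (LandauFree H → E3)} {τ : ℝ} (hτ : gaussAvg β H (fun a => 1 - D.indicator (fun _ => (1 : ℝ)) a) ≤ τ) : 0 ≤ τ :=
  le_trans (EdgeChartGaussian.gaussAvg_nonneg H hβ fun a => by linarith [(indicator_one_nonneg_le_one D a).2]) hτ

/-- ★ **SINGLE-AVERAGE TRANSFER**: `E₀[1 − 1_D] ≤ τ ≤ 1/2`, `V` measurable with `V²·gaussWeight` integrable ⇒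
`|E₀[1_D V]/E₀[1_D] − E₀[V]| ≤ 2τ·|E₀ V| + 2√τ·√E₀[V²]`. -/
theorem abs_rSet_sub_gaussAvg_le (hβ : 0 < β) {D : Set (LandauFree H → E3)} (hD : MeasurableSet D) {τ : ℝ} (hτ : gaussAvg β H (fun a => 1 - D.indicator (fun _ => (1 : ℝ)) a) ≤ τ) (hτ2 : τ ≤ 1 / 2)
    {V : (LandauFree H → E3) → ℝ} (hV : Measurable V) (hV2 : Integrable (fun a => V a ^ 2 * gaussWeight β H a)) :
    |gaussAvg β H (fun a => D.indicator (fun _ => (1 : ℝ)) a * V a) / gaussAvg β H (D.indicator (fun _ => (1 : ℝ))) - gaussAvg β H V| ≤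
      2 * τ * |gaussAvg β H V| + 2 * Real.sqrt τ * Real.sqrt (gaussAvg β H (fun a => V a ^ 2)) := by
  have hp := half_le_gaussAvg_indicator hβ hD hτ hτ2
  have hp0 : 0 < gaussAvg β H (D.indicator (fun _ => (1 : ℝ))) := by linarith
  have htail := abs_gaussAvg_one_sub_indicator_mul_le hβ hD hτ hV hV2
  have hsplit := gaussAvg_indicator_mul_eq_sub hβ hD hV hV2
  have hpe : gaussAvg β H (D.indicator (fun _ => (1 : ℝ))) = 1 - gaussAvg β H (fun a => 1 - D.indicator (fun _ => (1 : ℝ)) a) := gaussAvg_indicator_eq hβ hD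
  set p := gaussAvg β H (D.indicator (fun _ => (1 : ℝ))) with hpdef
  set τ' := gaussAvg β H (fun a => 1 - D.indicator (fun _ => (1 : ℝ)) a) with hτ'def
  set e := gaussAvg β H V
  set c := gaussAvg β H (fun a => (1 - D.indicator (fun _ => (1 : ℝ)) a) * V a)
  have hτ'0 : 0 ≤ τ' := tau_nonneg_set (D := D) hβ le_rfl
  have key : gaussAvg β H (fun a => D.indicator (fun _ => (1 : ℝ)) a * V a) / p - e = (τ' * e - c) / p := by
    rw [hsplit, hpe]
    have : (1 : ℝ) - τ' ≠ 0 := by rw [← hpe]; exact hp0.ne'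
    field_simp
    ring
  rw [key, abs_div, abs_of_pos hp0, div_le_iff₀ hp0]
  have h1 : |τ' * e - c| ≤ τ' * |e| + |c| := by
    have := abs_sub (τ' * e) c
    rwa [abs_mul, abs_of_nonneg hτ'0] at this
  have h2 : τ' * |e| ≤ τ * |e| := mul_le_mul_of_nonneg_right hτ (abs_nonneg _)
  have hs0 : 0 ≤ Real.sqrt τ * Real.sqrt (gaussAvg β H (fun a => V a ^ 2)) := mul_nonneg (Real.sqrt_nonneg _) (Real.sqrt_nonneg _)
  have hτ0 : 0 ≤ τ := hτ'0.trans hτ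
  have hX : 0 ≤ 2 * τ * |e| + 2 * Real.sqrt τ * Real.sqrt (gaussAvg β H (fun a => V a ^ 2)) := by
    have := abs_nonneg e; positivity
  have hXp := mul_le_mul_of_nonneg_left hp hX
  linarith [h1, h2, htail, hXp]

/-- ★ **SINGLE-AVERAGE TRANSFER, size form**: with `E₀[V²] ≤ A`, `|E₀[1_D V]/E₀[1_D] − E₀[V]| ≤ 4√τ·√A`. -/
theorem abs_rSet_sub_gaussAvg_le_of_sq_le (hβ : 0 < β) {D : Set (LandauFree H → E3)} (hD : MeasurableSet D) {τ : ℝ} (hτ : gaussAvg β H (fun a => 1 - D.indicator (fun _ => (1 : ℝ)) a) ≤ τ)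
    (hτ2 : τ ≤ 1 / 2) {V : (LandauFree H → E3) → ℝ} (hV : Measurable V) (hV2 : Integrable (fun a => V a ^ 2 * gaussWeight β H a))
    {A : ℝ} (hA : gaussAvg β H (fun a => V a ^ 2) ≤ A) :
    |gaussAvg β H (fun a => D.indicator (fun _ => (1 : ℝ)) a * V a) / gaussAvg β H (D.indicator (fun _ => (1 : ℝ))) - gaussAvg β H V| ≤ 4 * Real.sqrt τ * Real.sqrt A := by
  have h := abs_rSet_sub_gaussAvg_le hβ hD hτ hτ2 hV hV2
  have he := abs_gaussAvg_le_sqrt_sq hβ hV hV2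
  have hτ0 := tau_nonneg_set hβ hτ
  have hsA : Real.sqrt (gaussAvg β H (fun a => V a ^ 2)) ≤ Real.sqrt A := Real.sqrt_le_sqrt hA
  have hτs : τ ≤ Real.sqrt τ := by
    have h1 : Real.sqrt τ * Real.sqrt τ = τ := Real.mul_self_sqrt hτ0
    have h2 : Real.sqrt τ ≤ 1 := (Real.sqrt_le_sqrt (show τ ≤ 1 by linarith)).trans (le_of_eq Real.sqrt_one)
    nlinarith [Real.sqrt_nonneg τ]
  have hS0 := Real.sqrt_nonneg (gaussAvg β H (fun a => V a ^ 2))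
  nlinarith [Real.sqrt_nonneg τ, Real.sqrt_nonneg A, abs_nonneg (gaussAvg β H V), mul_le_mul hτs (he.trans hsA) (abs_nonneg _) (Real.sqrt_nonneg _),
    mul_le_mul_of_nonneg_left hsA (Real.sqrt_nonneg τ)]

/-- **Size of a restricted average**: `|E₀[1_D V]/E₀[1_D]| ≤ 2·√E₀[V²]` (for `E₀[1_D] ≥ 1/2`). -/
theorem abs_rSet_le (hβ : 0 < β) {D : Set (LandauFree H → E3)} (hD : MeasurableSet D) {τ : ℝ} (hτ : gaussAvg β H (fun a => 1 - D.indicator (fun _ => (1 : ℝ)) a) ≤ τ) (hτ2 : τ ≤ 1 / 2)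
    {V : (LandauFree H → E3) → ℝ} (hV : Measurable V) (hV2 : Integrable (fun a => V a ^ 2 * gaussWeight β H a)) :
    |gaussAvg β H (fun a => D.indicator (fun _ => (1 : ℝ)) a * V a) / gaussAvg β H (D.indicator (fun _ => (1 : ℝ)))| ≤ 2 * Real.sqrt (gaussAvg β H (fun a => V a ^ 2)) := by
  have hp := half_le_gaussAvg_indicator hβ hD hτ hτ2
  have hp0 : 0 < gaussAvg β H (D.indicator (fun _ => (1 : ℝ))) := by linarith
  -- Cauchy–Schwarz with `1_D² = 1_D ≤ 1`
  have hm := (measurable_const.indicator hD : Measurable (D.indicator (fun _ => (1 : ℝ))))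
  have hF2 : Integrable (fun a : LandauFree H → E3 => D.indicator (fun _ => (1 : ℝ)) a ^ 2 * gaussWeight β H a) :=
    Tilt.integrable_bdd_mul_gaussWeight H hβ (hm.pow_const 2) (C := 1) fun a => by
      obtain ⟨h0, h1⟩ := indicator_one_nonneg_le_one D a
      rw [sq, indicator_one_mul_self, abs_of_nonneg h0]; exact h1
  have hFG : Integrable (fun a : LandauFree H → E3 => D.indicator (fun _ => (1 : ℝ)) a * V a * gaussWeight β H a) := by
    have hG : Integrable (fun a : LandauFree H → E3 => (1 + V a ^ 2) / 2 * gaussWeight β H a) := by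
      have h1 := EdgeChartGaussian.integrable_gaussWeight H hβ
      exact ((h1.add hV2).div_const 2).congr (Filter.Eventually.of_forall fun a => by simp only [Pi.add_apply]; ring)
    refine EdgeChartGaussian.integrable_mul_gaussWeight_of_abs_le H hβ (hm.mul hV) hG fun a => ?_
    obtain ⟨h0, h1⟩ := indicator_one_nonneg_le_one D a
    rw [abs_mul, abs_of_nonneg h0]
    calc D.indicator (fun _ => (1 : ℝ)) a * |V a| ≤ 1 * |V a| := mul_le_mul_of_nonneg_right h1 (abs_nonneg _)
      _ ≤ (1 + V a ^ 2) / 2 := by rw [one_mul]; exact abs_le_half_one_add_sq (V a)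
  have h := EdgeChartGaussian.abs_gaussAvg_mul_le_sqrt H hβ hF2 hV2 hFG
  have hsq : gaussAvg β H (fun a => D.indicator (fun _ => (1 : ℝ)) a ^ 2) = gaussAvg β H (D.indicator (fun _ => (1 : ℝ))) := by
    congr 1; funext a; rw [sq, indicator_one_mul_self]
  rw [hsq] at h
  have hp1 : Real.sqrt (gaussAvg β H (D.indicator (fun _ => (1 : ℝ)))) ≤ 1 := by
    refine (Real.sqrt_le_sqrt ?_).trans (le_of_eq Real.sqrt_one)
    have := gaussAvg_indicator_eq hβ hD
    have h0 : 0 ≤ gaussAvg β H (fun a => 1 - D.indicator (fun _ => (1 : ℝ)) a) := tau_nonneg_set (D := D) hβ le_rfl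
    linarith
  have hnum : |gaussAvg β H (fun a => D.indicator (fun _ => (1 : ℝ)) a * V a)| ≤ Real.sqrt (gaussAvg β H (fun a => V a ^ 2)) := by
    calc |gaussAvg β H (fun a => D.indicator (fun _ => (1 : ℝ)) a * V a)| ≤ Real.sqrt (gaussAvg β H (D.indicator (fun _ => (1 : ℝ)))) * Real.sqrt (gaussAvg β H (fun a => V a ^ 2)) := h
      _ ≤ 1 * Real.sqrt (gaussAvg β H (fun a => V a ^ 2)) := mul_le_mul_of_nonneg_right hp1 (Real.sqrt_nonneg _)
      _ = _ := one_mul _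
  rw [abs_div, abs_of_pos hp0, div_le_iff₀ hp0]
  nlinarith [Real.sqrt_nonneg (gaussAvg β H (fun a => V a ^ 2)), hnum, hp]


end GaussRestrict

end Summit.QuantumFields.YangMills.Theorems.AllWindowsColdBoxBoxHighLine

end
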